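import Literature.NumberTheory.EllipticCurves.KuriharaNumber
import Literature.NumberTheory.EllipticCurves.PAdicLFunctionIntegralityAtTwoProofs
import HarnessLib

/-!
# The MOD-2 Kurihara number vanishes identically at levels whose primes are `≡ 1 (mod 4)` — Kim's criterion read
# literally at `p = 2` is VACUOUS (cell `b2b-bsdres`, O1 sub-cell `p = 2`; lens-4 GEN 7 finding C164 (iv)(a), "to the
# typer's checklist and the barrier notes"; cc-typer-4 GEN 6)

HONEST FRAMING (run/shared/lean/b2b/bsd-rank1-residual/, verbatim in every file): the goal of the cell is to DELETE
the COMBINATION-SHAPED residual classes of the Birch–Swinnerton-Dyer formula for ALL analytic-rank `≤ 1` elliptic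
curves over `ℚ` — "full BSD formula for every rank `≤ 1` curve in class `C`" assembled STRICTLY from published
theorems — so that the rank-`≤ 1` remainder becomes exactly the CONSTRUCTION-SHAPED classes, which are TYPED
(missing-input `Prop`s), NOT attempted. This is not "finishing BSD". THEOREMS only (no `def`, no named fact; nothing
asserted about a particular curve; nothing booked; no RESIDUAL-MAP mark moves). A BARRIER NOTE for the cell's own
typing: it records WHY lens-4's Kurihara door at `2` (R-KUR2′, `cells/o1/ROUTES-O1.md` §4.31–4.49) must be stated with
the HALVED number `u(n) = S_half(n) mod 2` and NOT with the tree's `kuriharaNumber f 2 n ψ` — o1 lead C164 (iv)(a):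
"all 3 OPEN Props `Kim2025.rankZero_…_of_kuriharaNumber_ne_zero_…_OPEN` LITERALLY at `p = 2` are VACUOUS —
`ψ_ℓ(−1) = 0` at `ℓ ≡ 1 (4)` and `[−r]⁺ = [r]⁺` make `kuriharaNumber f 2 n ψ = 2·S_half ≡ 0`, so 'δ_n ≢ 0' never fires;
the HALVED number is the DEFINITION, not a cosmetic".

THE THEOREM (`kuriharaNumber_two_eq_zero`). Let `f ∈ S₂(Γ₀(N))`, `n > 2`, and `ψ_ℓ : (ℤ/ℓ)ˣ → ℤ/2` (any homomorphisms)
with `ψ_ℓ(−1) = 0` for every prime `ℓ ∣ n` — AUTOMATIC when `ℓ ≡ 1 (mod 4)` (`−1` is then a square in `(ℤ/ℓ)ˣ`, so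
`ψ_ℓ(−1) = 2·ψ_ℓ(√−1) = 0`: `map_neg_one_eq_one_of_mod_four_eq_one`; every Kolyvagin prime at `p = 2` of level `k ≥ 2`
has `ℓ ≡ 1 (mod 4)`). Then `δ_n = kuriharaNumber f 2 n ψ = 0` in `ℤ/2`. PROOF: the summand
`g(a) = \overline{[a/n]⁺}·∏_ℓ ψ_ℓ(a)` is invariant under the fixed-point-free involution `a ↦ −a` of `(ℤ/n)ˣ`
(`[(n − a)/n]⁺ = [−a/n]⁺ = [a/n]⁺` by periodicity and evenness of the plus symbol, the tree's
`ratPlusSymbol_add_intCast_eq` / `ModularForms.ratPlusSymbol_neg`; `ψ_ℓ(−a) = ψ_ℓ(−1) + ψ_ℓ(a) = ψ_ℓ(a)`), so the sum is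
`Σ_{pairs} 2·g(a) = 0` in characteristic `2` (`Finset.sum_involution`). At a general modulus `m` the same pairing gives
`δ_n(ψ) = g-sum over a half-system doubled`; only the mod-`2` vanishing is recorded here. Nothing in print is
contradicted: Kurihara 2014 / Kim 2022–2025 assume `p` ODD throughout.

References: C.-H. Kim, arXiv:2203.12159, §1.4.3 (the numbers `δ̃_n^{(k)}`); M. Kurihara, Iwasawa Theory 2012 (2014)
§1.1; lens-4 `HOME/b2b-bsdres-o1-idea-4-g7/lean/SketchKIM2.lean` (the typed `halfKuriharaNumberTwo`, seat sketch, not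
in the tree).
-/

set_option autoImplicit false

noncomputable section

open scoped Classical MatrixGroups ModularForm

open CongruenceSubgroup Literature.NumberTheory.EllipticCurves Literature.NumberTheory.EllipticCurves.ModularForms
open Literature.NumberTheory.DiophantineGeometry.Dioph (ratModP)

namespace Summit.BirchSwinnertonDyer.Rank1Residual.Supersingular

/-! ## §1. `ψ(−1) = 0` for every `ψ : (ℤ/ℓ)ˣ → ℤ/2` when `ℓ ≡ 1 (mod 4)` -/

/-- For a prime `ℓ ≡ 1 (mod 4)`, `−1` is a square in `(ℤ/ℓ)ˣ`, so EVERY homomorphism `ψ : (ℤ/ℓ)ˣ → ℤ/2` kills it: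
`ψ(−1) = ψ(x²) = 2·ψ(x) = 0` (written multiplicatively: `ψ(−1) = 1`). [folklore] -/
theorem map_neg_one_eq_one_of_mod_four_eq_one {ℓ : ℕ} [hℓ : Fact ℓ.Prime] (h4 : ℓ % 4 = 1)
    (ψ : (ZMod ℓ)ˣ →* Multiplicative (ZMod 2)) : ψ (-1) = 1 := by
  obtain ⟨y, hy⟩ := (ZMod.exists_sq_eq_neg_one_iff (p := ℓ)).mpr (by omega)
  -- `hy : -1 = y * y`
  have hy0 : y ≠ 0 := by
    rintro rfl
    have : (-1 : ZMod ℓ) = 0 := by rw [hy, mul_zero]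
    exact one_ne_zero (neg_eq_zero.mp this)
  have hunit : (Units.mk0 y hy0) ^ 2 = -1 :=
    Units.ext (by rw [Units.val_pow_eq_pow_val, Units.val_mk0, Units.val_neg, Units.val_one, sq, ← hy])
  rw [← hunit, map_pow]
  -- squares vanish in `Multiplicative (ZMod 2)`
  have h2 : ∀ z : Multiplicative (ZMod 2), z ^ 2 = 1 := by decide
  exact h2 _

/-! ## §2. The summand of `δ_n` is invariant under `a ↦ −a` -/

section Summand

variable {N : ℕ} [NeZero N] (f : CuspForm (Gamma0 N) 2) {n : ℕ} [NeZero n] (m : ℕ)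

/-- Periodicity + evenness: **`[(−a).val/n]⁺ = [a.val/n]⁺`** for `a ∈ ℤ/n` (`(−a).val = n − a.val` for `a ≠ 0`;
`[1 − r]⁺ = [−r]⁺ = [r]⁺`). [cite: MazurTateTeitelbaum1986Invent, §I.8] -/
theorem ratPlusSymbol_neg_val_div_eq (a : ZMod n) :
    ratPlusSymbol f ((((-a).val : ℕ) : ℚ) / (n : ℚ)) = ratPlusSymbol f (((a.val : ℕ) : ℚ) / (n : ℚ)) := by
  by_cases ha : a = 0
  · subst ha; simp
  · have hn0 : (n : ℚ) ≠ 0 := by exact_mod_cast (NeZero.ne n)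
    rw [ZMod.neg_val, if_neg ha, Nat.cast_sub (ZMod.val_lt a).le]
    have : (((n : ℚ) - (a.val : ℚ)) / (n : ℚ)) = -(((a.val : ℕ) : ℚ) / (n : ℚ)) + ((1 : ℤ) : ℚ) := by
      field_simp
      push_cast
      ring
    rw [this, ratPlusSymbol_add_intCast_eq, ratPlusSymbol_neg]

omit [NeZero N] [NeZero n] in
/-- The discrete-log factor is invariant under `a ↦ −a` when every `ψ_ℓ` kills `−1`. [folklore] -/
theorem prod_toAdd_unitsMap_neg_eq (ψ : (q : ℕ) → (ZMod q)ˣ →* Multiplicative (ZMod m))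
    (hψ : ∀ ℓ ∈ n.primeFactors, ψ ℓ (-1) = 1) (a : (ZMod n)ˣ) :
    ∏ ℓ ∈ n.primeFactors.attach,
        Multiplicative.toAdd (ψ ℓ.1 (ZMod.unitsMap (Nat.dvd_of_mem_primeFactors ℓ.2) (-a))) =
      ∏ ℓ ∈ n.primeFactors.attach,
        Multiplicative.toAdd (ψ ℓ.1 (ZMod.unitsMap (Nat.dvd_of_mem_primeFactors ℓ.2) a)) := by
  refine Finset.prod_congr rfl fun ℓ _ => ?_
  have hneg : ZMod.unitsMap (Nat.dvd_of_mem_primeFactors ℓ.2) (-a) =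
      -1 * ZMod.unitsMap (Nat.dvd_of_mem_primeFactors ℓ.2) a := by
    rw [neg_one_mul]
    exact Units.ext (by simp [ZMod.unitsMap_def])
  rw [hneg, map_mul, hψ ℓ.1 ℓ.2, one_mul]

end Summand

/-! ## §3. The mod-2 Kurihara number vanishes -/

section Vanishing

variable {N : ℕ} [NeZero N] (f : CuspForm (Gamma0 N) 2) {n : ℕ} [NeZero n]

omit [NeZero n] in
/-- `−a ≠ a` in `(ℤ/n)ˣ` for `n > 2`. [folklore] -/
theorem neg_ne_self_of_two_lt (hn : 2 < n) (a : (ZMod n)ˣ) : -a ≠ a := by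
  intro h
  have h2 : (2 : ZMod n) * (a : ZMod n) = 0 := by
    have := congrArg (Units.val) h
    rw [Units.val_neg] at this
    linear_combination -this
  have h2' : (2 : ZMod n) = 0 := by
    have := congrArg (· * ((a⁻¹ : (ZMod n)ˣ) : ZMod n)) h2
    simpa [mul_assoc] using this
  have hdvd : n ∣ 2 := by
    have := (ZMod.natCast_eq_zero_iff 2 n).mp (by exact_mod_cast h2')
    exact this
  exact absurd (Nat.le_of_dvd two_pos hdvd) (by omega)

/-- **The MOD-2 Kurihara number VANISHES: `kuriharaNumber f 2 n ψ = 0` for `n > 2` whenever every `ψ_ℓ`, `ℓ ∣ n`,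
kills `−1`** (automatic for `ℓ ≡ 1 (mod 4)`, `map_neg_one_eq_one_of_mod_four_eq_one`). The summand is invariant under
the fixed-point-free involution `a ↦ −a` of `(ℤ/n)ˣ`, so the sum is a sum of doubles, zero in characteristic `2`.
Hence Kim's "`δ_n ≠ 0`" criterion transcribed LITERALLY to `p = 2` never fires — the halved number is the object
(lens-4 R-KUR2′; o1 lead C164 (iv)(a)). [folklore] -/
theorem kuriharaNumber_two_eq_zero (hn : 2 < n) (ψ : (q : ℕ) → (ZMod q)ˣ →* Multiplicative (ZMod 2))
    (hψ : ∀ ℓ ∈ n.primeFactors, ψ ℓ (-1) = 1) : kuriharaNumber f 2 n ψ = 0 := by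
  rw [kuriharaNumber_def]
  refine Finset.sum_involution (fun a _ => -a) ?_ ?_ (fun a _ => Finset.mem_univ _) (fun a _ => neg_neg a)
  · -- `g(a) + g(−a) = 2·g(a) = 0`
    intro a _
    rw [Units.val_neg, ratPlusSymbol_neg_val_div_eq f (a : ZMod n), prod_toAdd_unitsMap_neg_eq 2 ψ hψ a]
    have h2 : ∀ z : ZMod 2, z + z = 0 := by decide
    exact h2 _
  · intro a _ _
    exact neg_ne_self_of_two_lt hn a

/-- **At a level all of whose primes are `≡ 1 (mod 4)`** (e.g. every Kolyvagin level for `(E, 2)` of depth `k ≥ 2`,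
`ℓ ≡ 1 (mod 2^k)`): `kuriharaNumber f 2 n ψ = 0` for EVERY choice of the discrete logarithms. [folklore] -/
theorem kuriharaNumber_two_eq_zero_of_forall_mod_four (hn : 2 < n)
    (h4 : ∀ ℓ ∈ n.primeFactors, ℓ % 4 = 1) (ψ : (q : ℕ) → (ZMod q)ˣ →* Multiplicative (ZMod 2)) :
    kuriharaNumber f 2 n ψ = 0 := by
  refine kuriharaNumber_two_eq_zero f hn ψ fun ℓ hℓ => ?_
  haveI : Fact ℓ.Prime := ⟨Nat.prime_of_mem_primeFactors hℓ⟩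
  exact map_neg_one_eq_one_of_mod_four_eq_one (h4 ℓ hℓ) (ψ ℓ)

end Vanishing

end Summit.BirchSwinnertonDyer.Rank1Residual.Supersingular

end
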